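import Summits.ResolutionOfSingularities.ResolutionOfSingularities.Theorems.WeightedInvariantSuccessorRatioBoundChartModel
import HarnessLib

/-!
# (o56)(b′) ring side, PART 6 of 6 — FINAL FORM FROM THE THREE FRAME FACTS: `oneFlagRatioBound_of_frameFacts`, **`successorRatioBound_of_frameFacts`**,
# and the TORUS TRANSFER (`OneFlagRatioBound.of_map`, `successorRatioBound_of_map`, `SuccessorRatioBound.mul_of_isUnit`)

**Provenance / honest framing.** This is a VERBATIM PORT (proofs unchanged; namespace `…LocalEngine.Iota3.RatContact` instead of the sketch's
`…Iota3.R9`) of res-L1-w43-idea-2's kernel-checked sketch `Cruxes/WeightedConstruction/SketchL1w43Idea2R9.lean` (Sketch-R9, gen 9, tree copy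
b7197eb188e64d8c = 657de2227c79926d + the §15 unit-factor lemma; §14e as announced f30a0aee35c844fc), board item (o56-R9) of res-L1-w43-plan-1 (dealer word STATUS l.69360), res-plan-2 IDLE POOL
DEAL #52 (2); ported by res-L1-type-o4 so that `Theorems/` files (res-type-057's (D1) bundle for the door item `stmt-ResolutionOfSingularities-19897`
branch (o56)(b′)) can import it; `--supports stmt-ResolutionOfSingularities-0571 --as helper`. [OURS · L1 w43 · idea-2 R9] Every statement here is OURS
elementary commutative algebra over Mathlib and the tree's `flagContactFiltration` / `weightedMonomialIdeal` / unit-expansion calculus; every `def` is an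
OURS notion of the sketch (NOT a statement of H. Hironaka's 2017 manuscript, which is under adjudication and is neither asserted nor used); no Literature
fact is introduced; AI-written and AI-ported, weaker than expert review; nothing here is progress on resolution of singularities in positive characteristic.

## Contents (Sketch-R9 §14e, §15 verbatim)
From `S` regular of dimension `3` with frame `(x,y,z)` and the frame facts (F0) `f ∈ 𝔪_S^ν ∖ 𝔪_S^(ν+1)`, (F1) `f ∈ W((x,y,z);(1,b,0);bν)` (cylinder),
(F2) `f ∈ W((x,y,z);(q,r,0);rν)` (`δ_η`-prepared), (F3) `f ∉ W((x,y,z);(q,r+1,1);(r+1)ν)` (`τ = 0`), ANY ring map `φ : S → T` (`T` regular of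
dimension `3`) with `φ x = t`, `φ y = t^b·Y`, `φ(𝔪_S) ⊆ 𝔪_T`, `t ∉ 𝔪_T²`, `φ f = t^(bν)·f₁`, residue representatives `Λ ⊆ S` and persistence `f₁ ∈ 𝔪_T^ν`
⟹ `SuccessorRatioBound T f₁ ν q ρ` (`0 < b`, `0 < ν`, `0 < ρ < q`, `r = qb + ρ`). §15: the one-flag bound descends along any ring map `π : T' → T` with
`π(𝔪_T') ⊆ 𝔪_T`. What is left for the door (D1) is to EXHIBIT `φ` and the frame facts from the cell's CURVE° / `δ_η` / `τ` — res-type-057's object.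
-/

noncomputable section

open IsLocalRing Literature.AlgebraicGeometry.Resolution

set_option linter.dupNamespace false

namespace Summit.ResolutionOfSingularities.ResolutionOfSingularities.Cruxes.HypersurfaceCentreConstruction.LocalEngine

namespace Iota3

namespace RatContact

section FrameFacts

/-- [folklore] `W` is unchanged under `y ↦ y − c·x^{b+1}` whenever `w(y) ≤ w(x)·(b+1)`. -/
theorem frame_translate_eq {A : Type*} [CommRing A] (x y z c : A) (w : Fin 3 → ℕ) {b : ℕ} (h : w 1 ≤ w 0 * (b + 1))
    (n : ℕ) : weightedMonomialIdeal ![x, y - c * x ^ (b + 1), z] w n = weightedMonomialIdeal ![x, y, z] w n := by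
  have := weightedMonomialIdeal_update_add_mul_pow_eq ![x, y - c * x ^ (b + 1), z] w (i := 1) (j := 0)
    (by decide) c (b + 1) (by simpa using h) n
  rw [← this]
  congr 1
  ext l; fin_cases l <;> simp [Function.update]

/-- [folklore] The translated frame generates the same ideal. -/
theorem span_range_frame_translate {A : Type*} [CommRing A] (x y z c : A) (b : ℕ) :
    Ideal.span (Set.range ![x, y - c * x ^ (b + 1), z]) = Ideal.span (Set.range ![x, y, z]) := by
  rw [range_vec₃, range_vec₃]
  apply le_antisymm
  · rw [Ideal.span_le]
    refine Set.insert_subset_iff.mpr ⟨Ideal.subset_span (by simp), Set.insert_subset_iff.mpr ⟨?_, ?_⟩⟩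
    · have hx : x ∈ Ideal.span ({x, y, z} : Set A) := Ideal.subset_span (by simp)
      have hy : y ∈ Ideal.span ({x, y, z} : Set A) := Ideal.subset_span (by simp)
      exact sub_mem hy (Ideal.mul_mem_left _ c (Ideal.pow_mem_of_mem _ hx (b + 1) (Nat.succ_pos b)))
    · exact Set.singleton_subset_iff.mpr (Ideal.subset_span (by simp))
  · rw [Ideal.span_le]
    refine Set.insert_subset_iff.mpr ⟨Ideal.subset_span (by simp), Set.insert_subset_iff.mpr ⟨?_, ?_⟩⟩
    · have hx : x ∈ Ideal.span ({x, y - c * x ^ (b + 1), z} : Set A) := Ideal.subset_span (by simp)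
      have hy : y - c * x ^ (b + 1) ∈ Ideal.span ({x, y - c * x ^ (b + 1), z} : Set A) := Ideal.subset_span (by simp)
      have := add_mem hy (Ideal.mul_mem_left _ c (Ideal.pow_mem_of_mem _ hx (b + 1) (Nat.succ_pos b)))
      simpa using this
    · exact Set.singleton_subset_iff.mpr (Ideal.subset_span (by simp))

/-- Unfolding a three-letter weight. [folklore] -/
theorem weight_three (w₀ w₁ w₂ : ℕ) (α : Fin 3 → ℕ) : ∑ i, ![w₀, w₁, w₂] i * α i = w₀ * α 0 + w₁ * α 1 + w₂ * α 2 := by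
  simp [Fin.sum_univ_three]

variable {S T : Type*} [CommRing S] [IsRegularLocalRing S] [CommRing T] [IsRegularLocalRing T]

/-- [OURS · L1 w43 · R9 §14e · CANDIDATE-FREE] **(b′)'s ring side from the frame facts and a chart model.** -/
theorem oneFlagRatioBound_of_frameFacts (hdimS : ringKrullDim S = (3 : ℕ)) {x y z : S}
    (hu : Ideal.span (Set.range ![x, y, z]) = maximalIdeal S) (Λ : Set S) (φ : S →+* T)
    (hdimT : ringKrullDim T = (3 : ℕ)) {t Y : T} (h𝔪T : Ideal.span (Set.range ![t, φ z, Y]) = maximalIdeal T)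
    (hres : ∀ w : T, ∃ c ∈ Λ, w - φ c ∈ maximalIdeal T) {b ν q r ρ : ℕ} (hb : 0 < b) (hx : φ x = t)
    (hy : φ y = t ^ b * Y) (hφ : Ideal.map φ (maximalIdeal S) ≤ maximalIdeal T) (ht2 : t ∉ maximalIdeal T ^ 2)
    (hν : 0 < ν) (hρ : 0 < ρ) (hρq : ρ < q) (hr : r = q * b + ρ) {f : S} {f₁ : T} (hf₁ : φ f = t ^ (b * ν) * f₁)
    (hpers : f₁ ∈ maximalIdeal T ^ ν) (hF0 : f ∈ maximalIdeal S ^ ν) (hF0' : f ∉ maximalIdeal S ^ (ν + 1))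
    (hF1 : f ∈ weightedMonomialIdeal ![x, y, z] ![1, b, 0] (b * ν))
    (hF2 : f ∈ weightedMonomialIdeal ![x, y, z] ![q, r, 0] (r * ν))
    (hF3 : f ∉ weightedMonomialIdeal ![x, y, z] ![q, r + 1, 1] ((r + 1) * ν)) :
    OneFlagRatioBound T f₁ ν q ρ := by
  classical
  have hq : 0 < q := lt_of_le_of_lt (Nat.zero_le _) hρq
  have hqr : q < r := by
    have : q ≤ q * b := Nat.le_mul_of_pos_right q hb
    omega
  have hr0 : 0 < r := lt_of_le_of_lt (Nat.zero_le _) hqr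
  have hr1 : r + 1 ≤ q * (b + 1) := by rw [hr, Nat.mul_succ]; omega
  have hrle : r ≤ q * (b + 1) := by omega
  have hz : z ∈ maximalIdeal S := by
    simpa using Theorems.LocalGameEFTNewton.mem_maximalIdeal_of_span_eq ![x, y, z] hu 2
  refine oneFlagRatioBound_of_chart Λ φ hdimT h𝔪T hres hx hy hφ ht2 hz hν hρ hρq hr hf₁ hpers ?_
  intro c M
  -- the translated frame and the transported frame facts (§13)
  have huc : Ideal.span (Set.range ![x, y - c * x ^ (b + 1), z]) = maximalIdeal S := by
    rw [span_range_frame_translate, hu]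
  have hF1c : f ∈ weightedMonomialIdeal ![x, y - c * x ^ (b + 1), z] ![1, b, 0] (b * ν) := by
    rw [frame_translate_eq x y z c ![1, b, 0] (by simp)]; exact hF1
  have hF2c : f ∈ weightedMonomialIdeal ![x, y - c * x ^ (b + 1), z] ![q, r, 0] (r * ν) := by
    rw [frame_translate_eq x y z c ![q, r, 0] (by simpa using hrle)]; exact hF2
  have hF3c : f ∉ weightedMonomialIdeal ![x, y - c * x ^ (b + 1), z] ![q, r + 1, 1] ((r + 1) * ν) := by
    rw [frame_translate_eq x y z c ![q, r + 1, 1] (by simpa using hr1)]; exact hF3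
  -- one unit expansion, precision `N`
  set M' := M + (r + 1) * ν + ν + 1 with hM'
  have hM'pos : 0 < M' := by omega
  set N := M' * (r * ν) + M' * (b * ν) + M' + 1 with hN
  obtain ⟨Δ, a, hunit, -, hrem⟩ :=
    Theorems.LocalGameEFTNewton.exists_unitExpansion ![x, y - c * x ^ (b + 1), z] huc f N
  -- reading (a): cylinder-or-deep
  have hwa : ∀ i, 0 < (![M', M' * b, 1] : Fin 3 → ℕ) i := by
    intro i; fin_cases i <;> simp [hM'pos, hb]
  have hF1c' : f ∈ weightedMonomialIdeal ![x, y - c * x ^ (b + 1), z] ![M', M' * b, 1] (M' * (b * ν)) :=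
    weightedMonomialIdeal_mono_weights _ (w := ![1, b, 0]) (w' := ![M', M' * b, 1]) (L := M')
      (by intro i; fin_cases i <;> simp) _ hF1c
  have hreadA := Theorems.LocalGameEFTNewton.le_weight_of_mem_weightedMonomialIdeal ![x, y - c * x ^ (b + 1), z] huc
    hdimS ![M', M' * b, 1] hwa hunit hrem hF1c' (by rw [hN]; omega)
  have hcylM : ∀ α ∈ Δ, b * ν ≤ α 0 + b * α 1 ∨ M ≤ α 2 := by
    intro α hα
    have h := hreadA α hα
    rw [weight_three] at h
    have h' : M' * (b * ν) ≤ M' * (α 0 + b * α 1) + α 2 := by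
      calc M' * (b * ν) ≤ M' * α 0 + M' * b * α 1 + 1 * α 2 := h
        _ = M' * (α 0 + b * α 1) + α 2 := by ring
    rcases le_or_le_of_scaled h' with h1 | h1
    · exact Or.inl h1
    · exact Or.inr (by omega)
  -- reading (c): prepared-or-deep
  have hwc : ∀ i, 0 < (![M' * q, M' * r, 1] : Fin 3 → ℕ) i := by
    intro i; fin_cases i <;> simp [hM'pos, hq, hr0]
  have hF2c' : f ∈ weightedMonomialIdeal ![x, y - c * x ^ (b + 1), z] ![M' * q, M' * r, 1] (M' * (r * ν)) :=
    weightedMonomialIdeal_mono_weights _ (w := ![q, r, 0]) (w' := ![M' * q, M' * r, 1]) (L := M')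
      (by intro i; fin_cases i <;> simp) _ hF2c
  have hreadC := Theorems.LocalGameEFTNewton.le_weight_of_mem_weightedMonomialIdeal ![x, y - c * x ^ (b + 1), z] huc
    hdimS ![M' * q, M' * r, 1] hwc hunit hrem hF2c' (by rw [hN]; omega)
  have hprepM' : ∀ α ∈ Δ, r * ν ≤ q * α 0 + r * α 1 ∨ M' ≤ α 2 := by
    intro α hα
    have h := hreadC α hα
    rw [weight_three] at h
    have h' : M' * (r * ν) ≤ M' * (q * α 0 + r * α 1) + α 2 := by
      calc M' * (r * ν) ≤ M' * q * α 0 + M' * r * α 1 + 1 * α 2 := h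
        _ = M' * (q * α 0 + r * α 1) + α 2 := by ring
    exact le_or_le_of_scaled h'
  have hprep_of : ∀ α : Fin 3 → ℕ, r * ν ≤ q * α 0 + r * α 1 → r * (ν - α 1) ≤ q * α 0 := by
    intro α h
    rw [mul_tsub]
    exact tsub_le_iff_right.mpr h
  have hprepM : ∀ α ∈ Δ, r * (ν - α 1) ≤ q * α 0 ∨ M ≤ α 2 := by
    intro α hα
    rcases hprepM' α hα with h | h
    · exact Or.inl (hprep_of α h)
    · exact Or.inr (by omega)
  -- reading (b): the `τ = 0` witness (shallow, hence prepared)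
  have hwb : ∀ i, 0 < (![q, r + 1, 1] : Fin 3 → ℕ) i := by
    intro i; fin_cases i <;> simp [hq]
  obtain ⟨α₀, hα₀Δ, hlt⟩ := Theorems.LocalGameEFTNewton.exists_weight_lt_of_not_mem ![x, y - c * x ^ (b + 1), z] huc
    ![q, r + 1, 1] hwb hrem (by rw [hN]; omega) hF3c
  rw [weight_three, one_mul] at hlt
  have hα₀1 : α₀ 1 ≤ ν := by
    by_contra hgt
    have : (r + 1) * ν < (r + 1) * α₀ 1 := Nat.mul_lt_mul_of_pos_left (Nat.lt_of_not_le hgt) (Nat.succ_pos r)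
    omega
  obtain ⟨m, hm⟩ := Nat.exists_eq_add_of_le hα₀1
  have hm' : ν - α₀ 1 = m := by omega
  have hwit₀ : q * α₀ 0 + α₀ 2 < (r + 1) * (ν - α₀ 1) := by
    rw [hm']
    have : (r + 1) * ν = (r + 1) * α₀ 1 + (r + 1) * m := by rw [hm, mul_add]
    omega
  have hprep₀ : r * (ν - α₀ 1) ≤ q * α₀ 0 := by
    rcases hprepM' α₀ hα₀Δ with h | h
    · exact hprep_of α₀ h
    · exfalso; omega
  -- reading (d): `y^ν` is the unique exponent of degree `ν`
  obtain ⟨-, α₁, hα₁Δ, hdeg⟩ := Theorems.LocalGameEFTNewton.exists_degree_eq_of_not_mem_pow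
    ![x, y - c * x ^ (b + 1), z] huc hdimS hunit hrem hF0 hF0' (by rw [hN]; omega)
  rw [Fin.sum_univ_three] at hdeg
  have hyν : (![0, ν, 0] : Fin 3 → ℕ) ∈ Δ := by
    have hp : r * ν ≤ q * α₁ 0 + r * α₁ 1 := by
      rcases hprepM' α₁ hα₁Δ with h | h
      · exact h
      · exfalso; omega
    have hrν : r * ν = r * α₁ 0 + r * α₁ 1 + r * α₁ 2 := by rw [← hdeg]; ring
    have hα₁0 : α₁ 0 = 0 := by
      by_contra hne
      have hpos : 0 < α₁ 0 := Nat.pos_of_ne_zero hne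
      have : q * α₁ 0 < r * α₁ 0 := Nat.mul_lt_mul_of_pos_right hqr hpos
      omega
    have hα₁2 : α₁ 2 = 0 := by
      have h0 : r * α₁ 2 = 0 := by rw [hα₁0] at hp hrν; simp at hp hrν; omega
      rcases Nat.mul_eq_zero.mp h0 with h | h
      · omega
      · exact h
    have heq : α₁ = ![0, ν, 0] := by
      ext i; fin_cases i
      · simpa using hα₁0
      · show α₁ 1 = ν; omega
      · simpa using hα₁2
    rw [← heq]; exact hα₁Δ
  exact ⟨Δ, a, hunit, Ideal.pow_le_pow_right (by rw [hN]; omega) hrem, hcylM, hprepM, hyν, α₀, hα₀Δ, hprep₀, hwit₀⟩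

/-- The two-flag (`σ₁`) form of `oneFlagRatioBound_of_frameFacts` (kept under its name of record). [folklore] -/
theorem successorRatioBound_of_frameFacts (hdimS : ringKrullDim S = (3 : ℕ)) {x y z : S}
    (hu : Ideal.span (Set.range ![x, y, z]) = maximalIdeal S) (Λ : Set S) (φ : S →+* T)
    (hdimT : ringKrullDim T = (3 : ℕ)) {t Y : T} (h𝔪T : Ideal.span (Set.range ![t, φ z, Y]) = maximalIdeal T)
    (hres : ∀ w : T, ∃ c ∈ Λ, w - φ c ∈ maximalIdeal T) {b ν q r ρ : ℕ} (hb : 0 < b) (hx : φ x = t)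
    (hy : φ y = t ^ b * Y) (hφ : Ideal.map φ (maximalIdeal S) ≤ maximalIdeal T) (ht2 : t ∉ maximalIdeal T ^ 2)
    (hν : 0 < ν) (hρ : 0 < ρ) (hρq : ρ < q) (hr : r = q * b + ρ) {f : S} {f₁ : T} (hf₁ : φ f = t ^ (b * ν) * f₁)
    (hpers : f₁ ∈ maximalIdeal T ^ ν) (hF0 : f ∈ maximalIdeal S ^ ν) (hF0' : f ∉ maximalIdeal S ^ (ν + 1))
    (hF1 : f ∈ weightedMonomialIdeal ![x, y, z] ![1, b, 0] (b * ν))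
    (hF2 : f ∈ weightedMonomialIdeal ![x, y, z] ![q, r, 0] (r * ν))
    (hF3 : f ∉ weightedMonomialIdeal ![x, y, z] ![q, r + 1, 1] ((r + 1) * ν)) :
    SuccessorRatioBound T f₁ ν q ρ :=
  (oneFlagRatioBound_of_frameFacts hdimS hu Λ φ hdimT h𝔪T hres hb hx hy hφ ht2 hν hρ hρq hr hf₁ hpers hF0 hF0' hF1 hF2 hF3).successorRatioBound

end FrameFacts

section TorusTransfer

variable {T T' : Type*} [CommRing T] [IsLocalRing T] [CommRing T'] [IsLocalRing T']

/-- Contact grows under a ring map respecting the maximal ideals: `π(RC(g; a, b; n)) ⊆ RC(π g; a, b; n)`. [folklore] -/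
theorem ratContactFiltration_map_le (π : T' →+* T) (hπ : (maximalIdeal T').map π ≤ maximalIdeal T) (g : T') (a b n : ℕ) :
    (ratContactFiltration g a b n).map π ≤ ratContactFiltration (π g) a b n := by
  rw [ratContactFiltration_def, ratContactFiltration_def, Ideal.map_iSup]
  refine iSup_mono fun α => ?_
  rw [Ideal.map_mul, Ideal.map_span, Set.image_singleton, map_pow, Ideal.map_pow]
  exact Ideal.mul_mono_right (Ideal.pow_right_mono hπ _)

/-- [OURS · R9 · §15] **The one-flag ratio bound descends**: if `π f'` obeys it in `T` then `f'` obeys it in `T'`, for any ring map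
`π : T' → T` with `π(𝔪_{T'}) ⊆ 𝔪_T`. [folklore] -/
theorem OneFlagRatioBound.of_map {f' : T'} {ν q ρ : ℕ} (π : T' →+* T) (hπ : (maximalIdeal T').map π ≤ maximalIdeal T)
    (h : OneFlagRatioBound T (π f') ν q ρ) : OneFlagRatioBound T' f' ν q ρ := by
  intro g hg a b hb hba hmem
  exact h (π g) (hπ (Ideal.mem_map_of_mem π hg)) a b hb hba
    (ratContactFiltration_map_le π hπ g a b _ (Ideal.mem_map_of_mem π hmem))

/-- [OURS · R9 · §15] **`SuccessorRatioBound` in the bigger germ from the one-flag bound in a quotient / retract.** [folklore] -/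
theorem successorRatioBound_of_map {f' : T'} {ν q ρ : ℕ} (π : T' →+* T) (hπ : (maximalIdeal T').map π ≤ maximalIdeal T)
    (h : OneFlagRatioBound T (π f') ν q ρ) : SuccessorRatioBound T' f' ν q ρ :=
  (h.of_map π hπ).successorRatioBound

/-- The hypothesis `π(𝔪_{T'}) ⊆ 𝔪_T` for a local homomorphism. [folklore] -/
theorem map_maximalIdeal_le_of_isLocalHom (π : T' →+* T) [IsLocalHom π] : (maximalIdeal T').map π ≤ maximalIdeal T :=
  Ideal.map_le_iff_le_comap.mpr fun x hx => map_nonunit π x hx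

/-- The hypothesis `π(𝔪_{T'}) ⊆ 𝔪_T` for a surjection of local rings (e.g. `B_𝔫 → B_𝔫 ⧸ (v)`). [folklore] -/
theorem map_maximalIdeal_le_of_surjective (π : T' →+* T) (hπ : Function.Surjective π) :
    (maximalIdeal T').map π ≤ maximalIdeal T := by
  refine IsLocalRing.le_maximalIdeal fun htop => ?_
  obtain ⟨x, hx, hx1⟩ := (Ideal.mem_map_iff_of_surjective π hπ).mp (htop ▸ Submodule.mem_top : (1 : T) ∈ _)
  have hu : IsUnit (1 - x) := IsLocalRing.isUnit_one_sub_self_of_mem_nonunits x hx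
  have h0 : π (1 - x) = 0 := by rw [map_sub, map_one, hx1, sub_self]
  have := (hu.map π)
  rw [h0, isUnit_zero_iff] at this
  exact zero_ne_one this

/-- [OURS · R9 · §15] A unit factor does not change the bound (the door's `g = X^{bν}·f₁` on the `x`-chart, `X = x·t` a unit). [folklore] -/
theorem SuccessorRatioBound.mul_of_isUnit {f u : T'} {ν q ρ : ℕ} (hu : IsUnit u) (h : SuccessorRatioBound T' f ν q ρ) :
    SuccessorRatioBound T' (u * f) ν q ρ := by
  intro q' r₁ r₂ hadm hfl
  obtain ⟨g₁, g₂, hfl', hmem⟩ := hfl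
  refine h q' r₁ r₂ hadm ⟨g₁, g₂, hfl', ?_⟩
  obtain ⟨v, rfl⟩ := hu
  have hf : f = ↑v⁻¹ * (↑v * f) := by rw [← mul_assoc, Units.inv_mul, one_mul]
  rw [hf]
  exact Ideal.mul_mem_left _ _ hmem

/-- Usage: the bound at the door's successor germ `B_𝔫` from the bound in a quotient `B_𝔫 → T` by a local (e.g. surjective) map. -/
example (π : T' →+* T) [IsLocalHom π] {f' : T'} {ν q ρ : ℕ} (h : OneFlagRatioBound T (π f') ν q ρ) :
    SuccessorRatioBound T' f' ν q ρ :=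
  successorRatioBound_of_map π (map_maximalIdeal_le_of_isLocalHom π) h

example (π : T' →+* T) (hπ : Function.Surjective π) {f' : T'} {ν q ρ : ℕ} (h : OneFlagRatioBound T (π f') ν q ρ) :
    SuccessorRatioBound T' f' ν q ρ :=
  successorRatioBound_of_map π (map_maximalIdeal_le_of_surjective π hπ) h

end TorusTransfer

end RatContact

end Iota3

end Summit.ResolutionOfSingularities.ResolutionOfSingularities.Cruxes.HypersurfaceCentreConstruction.LocalEngine
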